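/-
Copyright (c) 2026. All rights reserved.
Released under Apache 2.0 license as described in the file LICENSE.
-/
import Mathlib
import Summits.MatrixMultiplication.MatrixMultiplication.Theorems.SubgroupIdentityDesigns.Negative.OrderSieve
import Summits.MatrixMultiplication.MatrixMultiplication.Theorems.SubgroupIdentityDesigns.Negative.LevelOneDimSqueeze

/-!
# The `(2,1)` cell of `SubgroupIdentityDesigns` is empty at every prime `p ≠ 31`

Route `LevelGradedCohnUmans`, crux `SubgroupIdentityDesigns` (stmt-MatrixMultiplication-14079), the
`(m,k) = (2,1)` cell.  VALUE = THEOREM / DECIDABLE VERDICT on one cell, NOT summit progress: the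
crux quantifies over all `(p, m, k)` and stays open.

* `cellTwoOne_empty_5`: at `p = 5` an exceptional member would have order `≥ 2 · 12 = 24 > p² - 3`
  (window), so all three members are of Cartan type (`|Hᵢ| = zᵢ vᵢ`, `vᵢ ≤ 6`, `z₁ z₂ z₃ ∣ 4`
  pairwise coprime), whence `|H₁||H₂||H₃| ≤ 20 · 6 · 6 = 720 ≤ 774` = the volume floor;
* **`cellTwoOne_empty_of_ne_31'`**: for EVERY prime `p ≠ 31` and every `0 < ε ≤ 1`, no subgroup
  triple of `GL₂(𝔽_p)` with the TPP and an identity design of rank level `≤ 1` satisfies the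
  crux inequality — assembling `p = 2` (`LevelOneDimSqueeze`), `p = 3` (`PThree`), `p = 5`
  (here), `7 ≤ p ≤ 43`, `p ≠ 31` (`OrderSieve`, kernel-evaluated sieve) and `p ≥ 47`
  (`DicksonTheorem.cellTwoOne_empty`).

`p = 31` is the one prime where the arithmetic admits profiles (exceptional member `2·A₅`,
`|H| = 120`); it is DATA-closed only (kit job j126482, ORACLE-g16 §G16-2), not a theorem.

Report: `run/shared/lean/b2b/levelgraded-cu/ORACLE-g17.md` (§G17-2d).
-/

set_option linter.dupNamespace false

noncomputable section

open scoped BigOperators Classical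

open Summit.MatrixMultiplication.MatrixMultiplication.Theorems.LieRankDesigns.Negative (GLm Mat budget)
open Literature.Barriers.MatrixMultiplication (SubgroupTPP)

namespace Summit.MatrixMultiplication.MatrixMultiplication.Theorems.SubgroupIdentityDesigns.Negative

section CellFive

variable {p : ℕ} [hp : Fact p.Prime]

/-- A `p`-free subgroup with a free vector and of order `< 24` is of Cartan type: its projective
image has order `≤ p + 1` (an exceptional one contains `-1` and has order `z · N ≥ 2 · 12`). -/
theorem image_le_of_card_lt (hp3 : 3 ≤ p) {n : ZMod p} (hn : ∀ x : ZMod p, x * x ≠ n)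
    {H : Subgroup (GLm p 2)} (hH : ¬ p ∣ Nat.card H)
    (hfree : ∃ a : Fin 2 → ZMod p, a ≠ 0 ∧
      ∀ h ∈ H, ((h : GLm p 2) : Mat p 2).mulVec a = a → h = 1)
    (hlt : Nat.card H < 24) :
    Nat.card (H.map (QuotientGroup.mk' (scalarHom p 2).range)) ≤ p + 1 := by
  have hp2 : p ≠ 2 := by omega
  rcases dickson_sharp hp2 hn hH with ⟨g, hg⟩ | ⟨g, hg⟩ | ⟨hmem, N, hN, hcard, -⟩
  · exact image_le_of_conj_monomial hp3 hg hfree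
  · exact image_le_of_conj_singerNormal hp3 hn hg hfree
  · exfalso
    have hpos : 0 < Nat.card H := Nat.card_pos
    obtain ⟨z, hz⟩ := two_dvd_card_comap_of_neg_one_mem hp2 hmem
    rw [hz] at hcard
    rcases hN with rfl | rfl | rfl <;> omega

/-- **The `(2,1)` cell is empty at `p = 5`** (`0 < ε ≤ 1`).  Decidable verdict, NOT summit
progress. -/
theorem cellTwoOne_empty_5 [h5 : Fact (Nat.Prime 5)] {ε : ℝ} (hε : 0 < ε) (hε1 : ε ≤ 1)
    {H₁ H₂ H₃ : Subgroup (GLm 5 2)} (htpp : SubgroupTPP H₁ H₂ H₃)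
    (hdesign : ∃ c : Mat 5 2 → ℂ, (∀ M, 1 < M.rank → c M = 0) ∧
      (∑ M, c M * ZMod.stdAddChar (Matrix.trace (M * ((1 : GLm 5 2) : Mat 5 2)))) = 1 ∧
      ∀ a ∈ H₁, ∀ b ∈ H₂, ∀ g ∈ H₃, a * b * g ≠ 1 →
        (∑ M, c M *
          ZMod.stdAddChar (Matrix.trace (M * ((a * b * g : GLm 5 2) : Mat 5 2)))) = 0) :
    ¬ budget 5 2 1 (2 + ε) <
      ((Nat.card H₁ * Nat.card H₂ * Nat.card H₃ : ℕ) : ℝ) ^ ((2 + ε) / 3) := by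
  intro hwit
  obtain ⟨n, hn0⟩ := FiniteField.exists_nonsquare (F := ZMod 5) (by
    rw [ZMod.ringChar_zmod_n]; decide)
  have hn : ∀ x : ZMod 5, x * x ≠ n := fun x hx => hn0 ⟨x, hx.symm⟩
  obtain ⟨-, hK₁, hK₂, hK₃⟩ :=
    levelOne_witness_pfree_profile (by norm_num) hε hε1 htpp hdesign hwit
  obtain ⟨hF₁, hF₂, hF₃⟩ := levelOne_witness_free_vector (by norm_num) hε hε1 htpp hdesign hwit
  obtain ⟨c₁₂, c₁₃, c₂₃, hprod⟩ := scalar_law htpp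
  obtain ⟨⟨hlo₁, hhi₁⟩, ⟨hlo₂, hhi₂⟩, ⟨hlo₃, hhi₃⟩⟩ :=
    levelOne_witness_window (by norm_num) (by linarith) hε1 htpp hdesign hwit
  have hfloor : 1 + 5 ^ 3 + (5 - 2) * (5 + 1) ^ 3 < Nat.card H₁ * Nat.card H₂ * Nat.card H₃ := by
    by_contra hle
    exact no_levelOne_witness_of_volume_le_nat (by linarith) hε1 (Nat.le_of_not_lt hle) hwit
  have hv₁ := image_le_of_card_lt (by norm_num) hn hK₁ hF₁ (by omega)
  have hv₂ := image_le_of_card_lt (by norm_num) hn hK₂ hF₂ (by omega)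
  have hv₃ := image_le_of_card_lt (by norm_num) hn hK₃ hF₃ (by omega)
  have e₁ := card_eq_scalar_mul_card_image H₁
  have e₂ := card_eq_scalar_mul_card_image H₂
  have e₃ := card_eq_scalar_mul_card_image H₃
  -- abstract the arithmetic
  generalize Nat.card (H₁.comap (scalarHom 5 2)) = z₁ at *
  generalize Nat.card (H₂.comap (scalarHom 5 2)) = z₂ at *
  generalize Nat.card (H₃.comap (scalarHom 5 2)) = z₃ at *
  generalize Nat.card (H₁.map (QuotientGroup.mk' (scalarHom 5 2).range)) = v₁ at *
  generalize Nat.card (H₂.map (QuotientGroup.mk' (scalarHom 5 2).range)) = v₂ at *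
  generalize Nat.card (H₃.map (QuotientGroup.mk' (scalarHom 5 2).range)) = v₃ at *
  generalize Nat.card H₁ = c₁ at *
  generalize Nat.card H₂ = c₂ at *
  generalize Nat.card H₃ = c₃ at *
  norm_num at hprod hhi₁ hhi₂ hhi₃ hfloor
  have hz₁ : z₁ ∣ 4 := Dvd.dvd.trans (Dvd.intro _ rfl) (Dvd.dvd.trans (Dvd.intro _ rfl) hprod)
  have hz₂ : z₂ ∣ 4 := Dvd.dvd.trans (Dvd.intro_left _ rfl) (Dvd.dvd.trans (Dvd.intro _ rfl) hprod)
  have hz₃ : z₃ ∣ 4 := Dvd.dvd.trans (Dvd.intro_left _ rfl) hprod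
  have hb₁ := Nat.le_of_dvd (by norm_num) hz₁
  have hb₂ := Nat.le_of_dvd (by norm_num) hz₂
  have hb₃ := Nat.le_of_dvd (by norm_num) hz₃
  -- pairwise coprimality in the form `omega` understands: not both even
  have h22 : ¬ Nat.Coprime 2 2 := by norm_num
  have n₁₂ : ¬ (2 ∣ z₁ ∧ 2 ∣ z₂) := fun h =>
    h22 (Nat.Coprime.coprime_dvd_left h.1 (Nat.Coprime.coprime_dvd_right h.2 c₁₂))
  have n₁₃ : ¬ (2 ∣ z₁ ∧ 2 ∣ z₃) := fun h =>
    h22 (Nat.Coprime.coprime_dvd_left h.1 (Nat.Coprime.coprime_dvd_right h.2 c₁₃))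
  have n₂₃ : ¬ (2 ∣ z₂ ∧ 2 ∣ z₃) := fun h =>
    h22 (Nat.Coprime.coprime_dvd_left h.1 (Nat.Coprime.coprime_dvd_right h.2 c₂₃))
  have hmono : ∀ B₁ B₂ B₃ : ℕ, c₁ ≤ B₁ → c₂ ≤ B₂ → c₃ ≤ B₃ →
      c₁ * c₂ * c₃ ≤ B₁ * B₂ * B₃ := fun B₁ B₂ B₃ h₁ h₂ h₃ =>
    Nat.mul_le_mul (Nat.mul_le_mul h₁ h₂) h₃
  clear c₁₂ c₁₃ c₂₃
  interval_cases z₁ <;> interval_cases z₂ <;> interval_cases z₃ <;>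
    first
    | omega
    | (refine absurd (hmono 20 6 6 ?_ ?_ ?_) ?_ <;> omega)
    | (refine absurd (hmono 6 20 6 ?_ ?_ ?_) ?_ <;> omega)
    | (refine absurd (hmono 6 6 20 ?_ ?_ ?_) ?_ <;> omega)

/-- **The `(2,1)` cell of `SubgroupIdentityDesigns` is empty at every prime `p ≠ 31`**
(`0 < ε ≤ 1`): no subgroup triple `(H₁, H₂, H₃)` of `GL₂(𝔽_p)` with the TPP and an identity
design supported on matrices of rank `≤ 1` satisfies
`budget(p,2,1,2+ε) < (|H₁||H₂||H₃|)^{(2+ε)/3}`.  Assembles `p = 2` (`LevelOneDimSqueeze`),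
`p = 3` (`PThree`), `p = 5`, the kernel-evaluated order sieve (`7 ≤ p ≤ 43`) and Dickson
(`p ≥ 47`).  ONE CELL of the crux; NOT summit progress. -/
theorem cellTwoOne_empty_of_ne_31' (hp31 : p ≠ 31) {ε : ℝ} (hε : 0 < ε) (hε1 : ε ≤ 1)
    {H₁ H₂ H₃ : Subgroup (GLm p 2)} (htpp : SubgroupTPP H₁ H₂ H₃)
    (hdesign : ∃ c : Mat p 2 → ℂ, (∀ M, 1 < M.rank → c M = 0) ∧
      (∑ M, c M * ZMod.stdAddChar (Matrix.trace (M * ((1 : GLm p 2) : Mat p 2)))) = 1 ∧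
      ∀ a ∈ H₁, ∀ b ∈ H₂, ∀ g ∈ H₃, a * b * g ≠ 1 →
        (∑ M, c M *
          ZMod.stdAddChar (Matrix.trace (M * ((a * b * g : GLm p 2) : Mat p 2)))) = 0) :
    ¬ budget p 2 1 (2 + ε) <
      ((Nat.card H₁ * Nat.card H₂ * Nat.card H₃ : ℕ) : ℝ) ^ ((2 + ε) / 3) := by
  by_cases hp7 : 7 ≤ p
  · exact cellTwoOne_empty_of_ne_31 hp7 hp31 hε hε1 htpp hdesign
  · intro hwit
    have hp' := hp.out
    have hp2 := hp'.two_le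
    interval_cases p
    · -- `p = 2`
      refine LevelOneDimSqueeze.no_levelOne_witness_small_eps (p := 2) (l := 1) le_rfl hε ?_
        htpp hdesign hwit
      have h1 : (0 : ℝ) < 2 := by norm_num
      rw [Nat.cast_ofNat]
      apply Real.rpow_le_rpow_of_exponent_le (by norm_num : (1 : ℝ) ≤ 2)
      linarith
    · exact no_levelOne_witness_three hε hε1 htpp hdesign hwit
    · exact absurd hp' (by decide)
    · exact cellTwoOne_empty_5 hε hε1 htpp hdesign hwit
    · exact absurd hp' (by decide)

end CellFive

end Summit.MatrixMultiplication.MatrixMultiplication.Theorems.SubgroupIdentityDesigns.Negative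

end
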